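import Summits.CriticalPhenomena.PercolationContinuityZ3.Theorems.PercNearOneGluingNoHeavyLowerTailAPLTreeFourPointStep
import Summits.CriticalPhenomena.PercolationContinuityZ3.Theorems.PercNearOneGluingNoHeavyLowerTailAPLProfileAll
import HarnessLib

/-!
# `NoHeavyLowerTail` (stmt-CriticalPhenomena-4575) — THE SHARP FOUR-POINT TREE INEQUALITY (T3′) FOR EVERY FINITE WEIGHTED GRAPH

Support file (prover prim-ineq-gen-8 gen 40; `--supports stmt-CriticalPhenomena-4575`; memo
run/shared/lean/prim/prim-ineq-gen-8/FINDING-gen40-T3.md).  No definitions, no named facts, no sorries.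

`μ = prodBernoulli w` on the pairs of a finite vertex type `V` (every pair open independently with probability `w e ∈ [0,1]`),
a root `a` and three further vertices `u, v, x` (not necessarily distinct).  Gen 39 conjectured (memo FINDING-gen39-TE-CORES.md §0(8),
"(T3′)": 0 violations among 6 232 exact quadruples, equality on stars at `a`) the sharp four-point inequality
  `P(a,u,v,x all joined) + Σ_{(y|z z')} P(a↔y, z↔z', a↮z) + 2·P(a↔u)P(a↔v)P(a↔x) ≤ Σ_{(y|z z')} P(a↔y)·P(z↔z')`,
the sums over the three ways `(u|vx), (v|ux), (x|uv)` of splitting `{u,v,x}` into a singleton and a pair.  WITHOUT the tree term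
`2·P(a↔u)P(a↔v)P(a↔x)` it is a consequence of the van den Berg–Kesten inequality (the percolation analogue of Lebowitz' `u₄ ≤ 0`);
WITH it, it is an identity on every tree in which `a` is the first branch point (e.g. stars at `a`), and summed against vertex loads it is
exactly gen 39's third-order tip inequality (P) `κ₃(L) + 3·Cov(L,R) ≤ 0`, i.e. `3·Cov(|C_a|, Σ_K |K|²) ≤ 2·(E|C_a|³ − (E|C_a|)³)`,
which gen 39 could only derive from APL-P through an idealised-cloud limit.  THIS FILE PROVES (T3′):
* **`treeFourPoint_glued`** — (T3′) for every GLUED APEX SET `S` (`I y := {S ~ y}`, glued connection `G(y,z) := {y↔z} ∪ (I y ∩ I z)`),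
  by induction on the number of pairs of positive weight: condition on one pair `s–t` leaving `S` (`real_eq_pin_zero_add_pin_one`),
  identify the `e`-open endpoint with the apex set `S ∪ {t}` (`pin_one_reach/reach3/split/glued`), and interpolate with the MIXING LEMMA
  (`treeFourPoint_mixture`: the slack is a convex cubic in the weight of the edge, thanks to the cross-row bound `glued_increment_le`,
  a van den Berg–Häggström–Kahn instance); if no live pair leaves `S` the slack vanishes (`dead_*`);
* **`treeFourPoint_all`** — (T3′) for every finite weighted graph and all `a, u, v, x` (`S = {a}`).
[this work]
-/

noncomputable section

namespace Summit.CriticalPhenomena.PercolationContinuityZ3.Theorems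

namespace APL

open MeasureTheory Set Literature.Probability.Percolation Literature.Probability.LatticeModels
open scoped Classical

variable {V : Type*}

/-! ### The induction -/

section Main

variable [Fintype V]

set_option maxHeartbeats 4000000 in
/-- **(T3′) for every glued apex set.**  For every weight function `w`, every finite set `S` of vertices and all `u, v, x`
(`I y := {S ~ y}`, `G(y,z) := {y↔z} ∪ (I y ∩ I z)`):
`μ(I u ∩ I v ∩ I x) + μ(I u ∩ (I v)ᶜ ∩ {v↔x}) + μ(I v ∩ (I u)ᶜ ∩ {u↔x}) + μ(I x ∩ (I u)ᶜ ∩ {u↔v}) + 2·μ(I u)μ(I v)μ(I x)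
  ≤ μ(I u)·μ(G(v,x)) + μ(I v)·μ(G(u,x)) + μ(I x)·μ(G(u,v))`.
Induction on the number of non-loop pairs of positive weight (memo §1). [this work] -/
theorem treeFourPoint_glued (u v x : V) :
    ∀ (n : ℕ) (w : Sym2 V → unitInterval) (S : Finset V),
      (Finset.univ.filter fun f : Sym2 V => ¬ f.IsDiag ∧ 0 < (w f : ℝ)).card = n →
      (prodBernoulli w).real ((⋃ y ∈ (↑S : Set V), (openConn y u : Set (BondConfig V)))
            ∩ (⋃ y ∈ (↑S : Set V), (openConn y v : Set (BondConfig V))) ∩ (⋃ y ∈ (↑S : Set V), (openConn y x : Set (BondConfig V))))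
        + (prodBernoulli w).real ((⋃ y ∈ (↑S : Set V), (openConn y u : Set (BondConfig V)))
            ∩ (⋃ y ∈ (↑S : Set V), (openConn y v : Set (BondConfig V)))ᶜ ∩ (openConn v x : Set (BondConfig V)))
        + (prodBernoulli w).real ((⋃ y ∈ (↑S : Set V), (openConn y v : Set (BondConfig V)))
            ∩ (⋃ y ∈ (↑S : Set V), (openConn y u : Set (BondConfig V)))ᶜ ∩ (openConn u x : Set (BondConfig V)))
        + (prodBernoulli w).real ((⋃ y ∈ (↑S : Set V), (openConn y x : Set (BondConfig V)))
            ∩ (⋃ y ∈ (↑S : Set V), (openConn y u : Set (BondConfig V)))ᶜ ∩ (openConn u v : Set (BondConfig V)))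
        + 2 * (prodBernoulli w).real (⋃ y ∈ (↑S : Set V), (openConn y u : Set (BondConfig V)))
            * (prodBernoulli w).real (⋃ y ∈ (↑S : Set V), (openConn y v : Set (BondConfig V)))
            * (prodBernoulli w).real (⋃ y ∈ (↑S : Set V), (openConn y x : Set (BondConfig V))) ≤
      (prodBernoulli w).real (⋃ y ∈ (↑S : Set V), (openConn y u : Set (BondConfig V)))
          * (prodBernoulli w).real ((openConn v x : Set (BondConfig V)) ∪
            ((⋃ y ∈ (↑S : Set V), (openConn y v : Set (BondConfig V))) ∩ (⋃ y ∈ (↑S : Set V), (openConn y x : Set (BondConfig V)))))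
        + (prodBernoulli w).real (⋃ y ∈ (↑S : Set V), (openConn y v : Set (BondConfig V)))
          * (prodBernoulli w).real ((openConn u x : Set (BondConfig V)) ∪
            ((⋃ y ∈ (↑S : Set V), (openConn y u : Set (BondConfig V))) ∩ (⋃ y ∈ (↑S : Set V), (openConn y x : Set (BondConfig V)))))
        + (prodBernoulli w).real (⋃ y ∈ (↑S : Set V), (openConn y x : Set (BondConfig V)))
          * (prodBernoulli w).real ((openConn u v : Set (BondConfig V)) ∪
            ((⋃ y ∈ (↑S : Set V), (openConn y u : Set (BondConfig V))) ∩ (⋃ y ∈ (↑S : Set V), (openConn y v : Set (BondConfig V))))) := by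
  intro n
  induction n using Nat.strong_induction_on with
  | _ n ih =>
  intro w S hcard
  by_cases hlive : ∃ s ∈ S, ∃ t, t ∉ S ∧ 0 < (w s(s, t) : ℝ)
  · -- (1) a live pair leaving `S`: condition on it
    obtain ⟨s, hs, t, ht, hpos⟩ := hlive
    have hst : s ≠ t := fun h => ht (h ▸ hs)
    have hed : ¬ (s(s, t)).IsDiag := by rwa [Sym2.mk_isDiag_iff]
    set w0 := pinW w ({s(s, t)} : Set (Sym2 V)) (∅ : Set (Sym2 V)) with hw0
    have hcard0 : (Finset.univ.filter fun f : Sym2 V => ¬ f.IsDiag ∧ 0 < (w0 f : ℝ)).card < n := by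
      rw [hw0, support_pin_zero w s(s, t), Finset.card_erase_of_mem, hcard]
      · have : 0 < n := by
          rw [← hcard]
          exact Finset.card_pos.2 ⟨s(s, t), Finset.mem_filter.2 ⟨Finset.mem_univ _, hed, hpos⟩⟩
        omega
      · exact Finset.mem_filter.2 ⟨Finset.mem_univ _, hed, hpos⟩
    have IH0 := ih _ hcard0 w0 S rfl
    have IH1 := ih _ hcard0 w0 (insert t S) rfl
    rw [Finset.coe_insert] at IH1
    -- the ten decompositions `X = (1 - z) X₀ + z X₁`
    have eIu := real_eq_pin_zero_add_pin_one w s(s, t) (⋃ y ∈ (↑S : Set V), (openConn y u : Set (BondConfig V)))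
    have eIv := real_eq_pin_zero_add_pin_one w s(s, t) (⋃ y ∈ (↑S : Set V), (openConn y v : Set (BondConfig V)))
    have eIx := real_eq_pin_zero_add_pin_one w s(s, t) (⋃ y ∈ (↑S : Set V), (openConn y x : Set (BondConfig V)))
    have eP := real_eq_pin_zero_add_pin_one w s(s, t) ((⋃ y ∈ (↑S : Set V), (openConn y u : Set (BondConfig V)))
      ∩ (⋃ y ∈ (↑S : Set V), (openConn y v : Set (BondConfig V))) ∩ (⋃ y ∈ (↑S : Set V), (openConn y x : Set (BondConfig V))))
    have eMu := real_eq_pin_zero_add_pin_one w s(s, t) ((⋃ y ∈ (↑S : Set V), (openConn y u : Set (BondConfig V)))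
      ∩ (⋃ y ∈ (↑S : Set V), (openConn y v : Set (BondConfig V)))ᶜ ∩ (openConn v x : Set (BondConfig V)))
    have eMv := real_eq_pin_zero_add_pin_one w s(s, t) ((⋃ y ∈ (↑S : Set V), (openConn y v : Set (BondConfig V)))
      ∩ (⋃ y ∈ (↑S : Set V), (openConn y u : Set (BondConfig V)))ᶜ ∩ (openConn u x : Set (BondConfig V)))
    have eMx := real_eq_pin_zero_add_pin_one w s(s, t) ((⋃ y ∈ (↑S : Set V), (openConn y x : Set (BondConfig V)))
      ∩ (⋃ y ∈ (↑S : Set V), (openConn y u : Set (BondConfig V)))ᶜ ∩ (openConn u v : Set (BondConfig V)))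
    have eGvx := real_eq_pin_zero_add_pin_one w s(s, t) ((openConn v x : Set (BondConfig V)) ∪
      ((⋃ y ∈ (↑S : Set V), (openConn y v : Set (BondConfig V))) ∩ (⋃ y ∈ (↑S : Set V), (openConn y x : Set (BondConfig V)))))
    have eGux := real_eq_pin_zero_add_pin_one w s(s, t) ((openConn u x : Set (BondConfig V)) ∪
      ((⋃ y ∈ (↑S : Set V), (openConn y u : Set (BondConfig V))) ∩ (⋃ y ∈ (↑S : Set V), (openConn y x : Set (BondConfig V)))))
    have eGuv := real_eq_pin_zero_add_pin_one w s(s, t) ((openConn u v : Set (BondConfig V)) ∪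
      ((⋃ y ∈ (↑S : Set V), (openConn y u : Set (BondConfig V))) ∩ (⋃ y ∈ (↑S : Set V), (openConn y v : Set (BondConfig V)))))
    rw [pin_one_reach w S hs ht u] at eIu
    rw [pin_one_reach w S hs ht v] at eIv
    rw [pin_one_reach w S hs ht x] at eIx
    rw [pin_one_reach3 w S hs ht u v x] at eP
    rw [pin_one_split w S hs ht u v x] at eMu
    rw [pin_one_split w S hs ht v u x] at eMv
    rw [pin_one_split w S hs ht x u v] at eMx
    rw [pin_one_glued w S hs ht v x] at eGvx
    rw [pin_one_glued w S hs ht u x] at eGux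
    rw [pin_one_glued w S hs ht u v] at eGuv
    rw [← hw0] at eIu eIv eIx eP eMu eMv eMx eGvx eGux eGuv
    rw [eIu, eIv, eIx, eP, eMu, eMv, eMx, eGvx, eGux, eGuv]
    exact treeFourPoint_mixture _ _ _ _ _ _ _ _ _ _ _ _ _ _ _ _ _ _ _ _ _
      (measureReal_mono (reach_subset_insert (↑S : Set V) t u) (measure_ne_top _ _))
      (measureReal_mono (reach_subset_insert (↑S : Set V) t v) (measure_ne_top _ _))
      (measureReal_mono (reach_subset_insert (↑S : Set V) t x) (measure_ne_top _ _))
      (glued_increment_le w0 (↑S : Set V) t v x) (glued_increment_le w0 (↑S : Set V) t u x)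
      (glued_increment_le w0 (↑S : Set V) t u v) IH0 IH1 (w s(s, t)).2.1 (w s(s, t)).2.2
  · -- (2) no live pair leaves `S`: the glued set is a.s. isolated and the slack vanishes
    push Not at hlive
    have hnull : ∀ y, y ∉ S → (prodBernoulli w).real (⋃ u ∈ (↑S : Set V), (openConn u y : Set (BondConfig V))) = 0 := by
      intro y hy
      have hsub : (⋃ u ∈ (↑S : Set V), (openConn u y : Set (BondConfig V))) ⊆
          {ω : BondConfig V | ∃ i ∈ (Finset.univ.filter fun f : Sym2 V => ∃ s ∈ S, ∃ t, t ∉ S ∧ f = s(s, t)), i ∈ ω} := by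
        intro ω hω
        simp only [mem_iUnion, exists_prop] at hω
        obtain ⟨u', hu', huy⟩ := hω
        obtain ⟨s, hs, t, htS, hst⟩ := exists_crossing_of_setConn (S := (↑S : Set V)) (fun h => hy (Finset.mem_coe.1 h)) ⟨u', hu', huy⟩
        exact ⟨s(s, t), Finset.mem_filter.2 ⟨Finset.mem_univ _, s, Finset.mem_coe.1 hs, t, fun h => htS (Finset.mem_coe.2 h), rfl⟩, hst⟩
      have hle := (measureReal_mono hsub (measure_ne_top _ _)).trans (prodBernoulli_real_exists_mem_le_sum w _)
      have hsum : ∑ i ∈ (Finset.univ.filter fun f : Sym2 V => ∃ s ∈ S, ∃ t, t ∉ S ∧ f = s(s, t)), (w i : ℝ) = 0 := by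
        refine Finset.sum_eq_zero fun i hi => ?_
        obtain ⟨s, hs, t, ht, rfl⟩ := (Finset.mem_filter.1 hi).2
        exact le_antisymm (hlive s hs t ht) (w s(s, t)).2.1
      rw [hsum] at hle
      exact le_antisymm hle measureReal_nonneg
    rw [dead_reach3 w S hnull u v x, dead_split w S hnull u v x, dead_split w S hnull v u x, dead_split w S hnull x u v,
      dead_reach w S hnull u, dead_reach w S hnull v, dead_reach w S hnull x, dead_glued w S hnull v x, dead_glued w S hnull u x,
      dead_glued w S hnull u v]
    by_cases hu : u ∈ S <;> by_cases hv : v ∈ S <;> by_cases hx : x ∈ S <;> simp [hu, hv, hx]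
    norm_num

/-- **THE SHARP FOUR-POINT TREE INEQUALITY (T3′) FOR EVERY FINITE WEIGHTED GRAPH.**  For all vertices `a, u, v, x`:
`P(a↔u, a↔v, a↔x) + P(a↔u, a↮v, v↔x) + P(a↔v, a↮u, u↔x) + P(a↔x, a↮u, u↔v) + 2·P(a↔u)·P(a↔v)·P(a↔x)
   ≤ P(a↔u)·P(v↔x) + P(a↔v)·P(u↔x) + P(a↔x)·P(u↔v)`
(the three middle terms on the left are the probabilities that the matching `{a,y},{z,z'}` is realised by two different clusters;
equality on every star centred at `a`). [this work] -/
theorem treeFourPoint_all (w : Sym2 V → unitInterval) (a u v x : V) :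
    (prodBernoulli w).real (openConn a u ∩ openConn a v ∩ openConn a x : Set (BondConfig V))
        + (prodBernoulli w).real (openConn a u ∩ (openConn a v)ᶜ ∩ openConn v x : Set (BondConfig V))
        + (prodBernoulli w).real (openConn a v ∩ (openConn a u)ᶜ ∩ openConn u x : Set (BondConfig V))
        + (prodBernoulli w).real (openConn a x ∩ (openConn a u)ᶜ ∩ openConn u v : Set (BondConfig V))
        + 2 * (prodBernoulli w).real (openConn a u : Set (BondConfig V)) * (prodBernoulli w).real (openConn a v : Set (BondConfig V))
          * (prodBernoulli w).real (openConn a x : Set (BondConfig V)) ≤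
      (prodBernoulli w).real (openConn a u : Set (BondConfig V)) * (prodBernoulli w).real (openConn v x : Set (BondConfig V))
        + (prodBernoulli w).real (openConn a v : Set (BondConfig V)) * (prodBernoulli w).real (openConn u x : Set (BondConfig V))
        + (prodBernoulli w).real (openConn a x : Set (BondConfig V)) * (prodBernoulli w).real (openConn u v : Set (BondConfig V)) := by
  have h := treeFourPoint_glued u v x _ w ({a} : Finset V) rfl
  simp only [Finset.coe_singleton, biUnion_singleton] at h
  have hG : ∀ y z : V, ((openConn y z : Set (BondConfig V)) ∪ (openConn a y ∩ openConn a z : Set (BondConfig V))) =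
      (openConn y z : Set (BondConfig V)) := by
    intro y z
    refine union_eq_self_of_subset_right fun ω hω => ?_
    exact SimpleGraph.Reachable.trans (SimpleGraph.Reachable.symm hω.1) hω.2
  rw [hG v x, hG u x, hG u v] at h
  exact h

end Main

end APL

end Summit.CriticalPhenomena.PercolationContinuityZ3.Theorems

end
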